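import Summits.Ventures.CertifiedArithmetic.Expansions.CompressWindowGenericRounding

/-!
# The travelling window of COMPRESS at every precision `p ≥ 3` (new work)

New work of the certified-arithmetic venture (ENGINES group: shared numerical engines serving
client cells; rigour lives in the verifiers; every published number belongs to a client cell's
ledger, not to the engines group).  NOT a published theorem:
Shewchuk [Shewchuk1997, §2.7] proves Theorem 23 only and says nothing about iterating COMPRESS.
The `p`-SYMBOLIC form of `CompressWindow.lean` (its instance `p = 3`, recovered below by `norm_num`):
precision `p = q + 3`, `q : ℕ` arbitrary, IEEE ties-to-even `roundTiesEven (q + 3) em`, `em ≤ 0`;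
lists smallest component first; every FAST-TWO-SUM evaluated by [BoldoEtAl2023, §2.2] arithmetic with
the thirteen roundings of `CompressWindowGenericRounding.lean`.  Notation as there: `h = 2^(p−1) = 4·2^q`,
statements polynomial in `2^q` (`2^p = 8·2^q`, `2^(2p−1) = 32·(2^q)^2`, `2^(3p) = 512·(2^q)^3`, …).
* `compress_windowG`: `COMPRESS⟨h+1, −(h−1)·2^(2p−1), −(h−1)·2^(3p), −(h−1)·2^(4p), (3h/2+1)·2^(5p)⟩ =
  ⟨−(h−1), −(h−1)·2^p, (3h/2+1)·2^(2p), −(2h−1)·2^(4p−1), (3h/2+1)·2^(5p)⟩`, bottom carry `−(h−1)`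
  (`compressDown_windowG`).  Read at scale `2^(3pj)`: the pair block `⟨h+1, −(h−1)·2^(2p−1)⟩` below the
  KINK `⟨−(h−1), −(h−1)·2^p, (3h/2+1)·2^(2p)⟩·2^(3p)` becomes the kink one block lower plus the inert
  debris `⟨−(2h−1)·2^(4p−1), (3h/2+1)·2^(5p)⟩`.
* `compress_kinkG`, `compress_kinkG_final`: `COMPRESS⟨−(h−1), −(h−1)·2^p, (3h/2+1)·2^(2p)⟩ =
  ⟨1, −(2h−1)·2^(p−1), (3h/2+1)·2^(2p)⟩`, which is then fixed.
* `windowG_inert`: the four inert neighbour FAST-TWO-SUMs (pair block, block boundary, kink over pair,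
  summit over kink top) = the chain hypotheses of locality (`CompressLocality.lean`).
* `compress_windowG_three`, `compress_kinkG_three`, `compress_kinkG_final_three`: `q = 0` gives literally
  the statements `compress_window3`, `compress_kink3`, `compress_kink3_final` of `CompressWindow.lean`.
With scale covariance (`CompressScaling.lean`) and locality (`CompressLocality.lean`) these are the
engines of a `p`-generic family with `2k + 4` components and exactly `k + 1` COMPRESS passes (the `p = 3`
family is `CompressPassesUnbounded.lean`); that family is not in this file (exact-model check only).
-/

namespace Summit.Ventures.CertifiedArithmetic.Expansions

open Literature.ComputerArithmetic.JeannerodRump2018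
open Literature.ComputerArithmetic.BoldoJeannerodMelquiondMuller2023 hiding twoSum twoSum_fst
open Literature.ComputerArithmetic.Shewchuk1997

variable {q : ℕ} {em : ℤ}

/-- FAST-TWO-SUM of floats `|b| ≤ |a|` is `(fl(a+b), a+b−fl(a+b))`. [cite: Shewchuk1997, Thm 6] -/
private theorem f2s_eqG {p : ℕ} {emin : ℤ} {fl : ℚ → ℚ} (hp : 1 ≤ p)
    (hfl : IsRoundNearest p emin fl) {a b s : ℚ} (ha : IsFloat p emin a) (hb : IsFloat p emin b)
    (hab : |b| ≤ |a|) (hs : fl (a + b) = s) : fastTwoSum fl a b = (s, a + b - s) := by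
  obtain ⟨h1, -, h2, -⟩ := fastTwoSum_exact hp hfl ha hb hab
  exact Prod.ext (by rw [h1, hs]) (by rw [h2, hs])

/-- `M·2^n` with `|M| < 2^p` and `n : ℕ` is a float for every `em ≤ 0`. [cite: JeannerodRump2018, §1] -/
private theorem isFloat_natG {p : ℕ} {em : ℤ} (he : em ≤ 0) {x : ℚ} (M : ℤ) (n : ℕ)
    (hx : x = (M : ℚ) * 2 ^ n) (hM : |M| < 2 ^ p) : IsFloat p em x :=
  ⟨M, n, hM, le_trans he (Int.natCast_nonneg n), by rw [hx, zpow_natCast]⟩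


/-! ### Three aliases, the signs and the floats -/


/-- Read from the up-sweep: `(h+1)·2^p + (−(h−1)) ↦ (h+1)·2^p`. [cite: BoldoEtAl2023, §2.2] -/
theorem rneG_c2_a' (he : em ≤ 0) :
    roundTiesEven (q + 3) em ((4 * 2 ^ q + 1) * (8 * 2 ^ q) + -(4 * 2 ^ q - 1)) = (4 * 2 ^ q + 1) * (8 * 2 ^ q) := by
  rw [show ((4 * 2 ^ q + 1) * (8 * 2 ^ q) + -(4 * 2 ^ q - 1) : ℚ) = 32 * (2 ^ q) ^ 2 + (4 * 2 ^ q + 1) by ring]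
  exact rneG_c2_a he

/-- Read from the final kink: `−(2h−1)·2^(p−1) + 1 ↦ −(2h−1)·2^(p−1)`. [cite: BoldoEtAl2023, §2.2] -/
theorem rneG_f1_one (he : em ≤ 0) :
    roundTiesEven (q + 3) em (-(8 * 2 ^ q - 1) * (4 * 2 ^ q) + 1) = -(8 * 2 ^ q - 1) * (4 * 2 ^ q) := by
  rw [show (-(8 * 2 ^ q - 1) * (4 * 2 ^ q) + 1 : ℚ) = -(4 * 2 ^ q - 1) * (8 * 2 ^ q) + -(4 * 2 ^ q - 1) by ring]
  exact rneG_m1_m0 he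

/-- One step earlier: `(3h/2+1)·2^(2p) + (−(h−1))·2^p ↦ (3h/2+1)·2^(2p)`. [cite: BoldoEtAl2023, §2.2] -/
theorem rneG_m2_m1 (he : em ≤ 0) :
    roundTiesEven (q + 3) em ((6 * 2 ^ q + 1) * (64 * (2 ^ q) ^ 2) + -(4 * 2 ^ q - 1) * (8 * 2 ^ q)) = (6 * 2 ^ q + 1) * (64 * (2 ^ q) ^ 2) := by
  rw [show ((6 * 2 ^ q + 1) * (64 * (2 ^ q) ^ 2) + -(4 * 2 ^ q - 1) * (8 * 2 ^ q) : ℚ) = 384 * (2 ^ q) ^ 3 + (4 * 2 ^ q + 1) * (8 * 2 ^ q) by ring]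
  exact rneG_g3_g4 he

/-- Signs of the seventeen values (`2^q ≥ 1`). -/
private theorem signsG (q : ℕ) :
    (0 : ℚ) < (6 * 2 ^ q + 1) * (32768 * (2 ^ q) ^ 5) ∧
      -(4 * 2 ^ q - 1) * (4096 * (2 ^ q) ^ 4) < (0 : ℚ) ∧
      -(4 * 2 ^ q - 1) * (512 * (2 ^ q) ^ 3) < (0 : ℚ) ∧
      -(4 * 2 ^ q - 1) * (32 * (2 ^ q) ^ 2) < (0 : ℚ) ∧
      (0 : ℚ) < (4 * 2 ^ q + 1) ∧
      (0 : ℚ) < 512 * (2 ^ q) ^ 3 ∧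
      (0 : ℚ) < 32 * (2 ^ q) ^ 2 ∧
      -(8 * 2 ^ q - 1) * (2048 * (2 ^ q) ^ 4) < (0 : ℚ) ∧
      (0 : ℚ) < 384 * (2 ^ q) ^ 3 ∧
      (0 : ℚ) < (4 * 2 ^ q + 1) * (8 * 2 ^ q) ∧
      -(4 * 2 ^ q - 1) < (0 : ℚ) ∧
      -(4 * 2 ^ q - 1) * (8 * 2 ^ q) < (0 : ℚ) ∧
      (0 : ℚ) < (6 * 2 ^ q + 1) * (64 * (2 ^ q) ^ 2) ∧
      -(8 * 2 ^ q - 1) * (4 * 2 ^ q) < (0 : ℚ) ∧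
      (0 : ℚ) < 1 ∧
      -(4 * 2 ^ q + 1) * (4096 * (2 ^ q) ^ 4) < (0 : ℚ) ∧
      (0 : ℚ) < (4 * 2 ^ q + 1) * (512 * (2 ^ q) ^ 3) := by
  obtain ⟨hY, hY2, hY3, hY4, hY5, hY6⟩ := yfactsG q
  refine ⟨?_, ?_, ?_, ?_, ?_, ?_, ?_, ?_, ?_, ?_, ?_, ?_, ?_, ?_, ?_, ?_, ?_⟩ <;> nlinarith

/-- The seventeen floats of the window, the kink, its final form, the summit and the next block's
bottom (`p = q + 3`; significands `±(h±1)`, `±(2h−1)`, `3h/2+1`, `1`, `3`). [cite: JeannerodRump2018, §1] -/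
theorem windowG_isFloat (he : em ≤ 0) :
    IsFloat (q + 3) em ((6 * 2 ^ q + 1) * (32768 * (2 ^ q) ^ 5) : ℚ) ∧
      IsFloat (q + 3) em (-(4 * 2 ^ q - 1) * (4096 * (2 ^ q) ^ 4) : ℚ) ∧
      IsFloat (q + 3) em (-(4 * 2 ^ q - 1) * (512 * (2 ^ q) ^ 3) : ℚ) ∧
      IsFloat (q + 3) em (-(4 * 2 ^ q - 1) * (32 * (2 ^ q) ^ 2) : ℚ) ∧
      IsFloat (q + 3) em ((4 * 2 ^ q + 1) : ℚ) ∧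
      IsFloat (q + 3) em (512 * (2 ^ q) ^ 3 : ℚ) ∧
      IsFloat (q + 3) em (32 * (2 ^ q) ^ 2 : ℚ) ∧
      IsFloat (q + 3) em (-(8 * 2 ^ q - 1) * (2048 * (2 ^ q) ^ 4) : ℚ) ∧
      IsFloat (q + 3) em (384 * (2 ^ q) ^ 3 : ℚ) ∧
      IsFloat (q + 3) em ((4 * 2 ^ q + 1) * (8 * 2 ^ q) : ℚ) ∧
      IsFloat (q + 3) em (-(4 * 2 ^ q - 1) : ℚ) ∧
      IsFloat (q + 3) em (-(4 * 2 ^ q - 1) * (8 * 2 ^ q) : ℚ) ∧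
      IsFloat (q + 3) em ((6 * 2 ^ q + 1) * (64 * (2 ^ q) ^ 2) : ℚ) ∧
      IsFloat (q + 3) em (-(8 * 2 ^ q - 1) * (4 * 2 ^ q) : ℚ) ∧
      IsFloat (q + 3) em (1 : ℚ) ∧
      IsFloat (q + 3) em (-(4 * 2 ^ q + 1) * (4096 * (2 ^ q) ^ 4) : ℚ) ∧
      IsFloat (q + 3) em ((4 * 2 ^ q + 1) * (512 * (2 ^ q) ^ 3) : ℚ) := by
  have h1 : (1 : ℤ) ≤ 2 ^ q := one_le_pow₀ (by norm_num)
  have hp : (2 : ℤ) ^ (q + 3) = 8 * 2 ^ q := by rw [pow_add]; ring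
  exact ⟨isFloat_natG he (6 * 2 ^ q + 1) (5 * q + 15) (by push_cast; rw [pow_add, pow_mul']; ring)
      (by rw [abs_of_pos (by positivity), hp]; linarith),
    isFloat_natG he (-(4 * 2 ^ q - 1)) (4 * q + 12) (by push_cast; rw [pow_add, pow_mul']; ring)
      (by rw [abs_of_neg (by linarith), hp]; linarith),
    isFloat_natG he (-(4 * 2 ^ q - 1)) (3 * q + 9) (by push_cast; rw [pow_add, pow_mul']; ring)
      (by rw [abs_of_neg (by linarith), hp]; linarith),
    isFloat_natG he (-(4 * 2 ^ q - 1)) (2 * q + 5) (by push_cast; rw [pow_add, pow_mul']; ring)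
      (by rw [abs_of_neg (by linarith), hp]; linarith),
    isFloat_natG he (4 * 2 ^ q + 1) (0) (by push_cast; ring)
      (by rw [abs_of_pos (by positivity), hp]; linarith),
    isFloat_natG he (1) (3 * q + 9) (by push_cast; rw [pow_add, pow_mul']; ring)
      (by rw [abs_of_pos (by positivity), hp]; linarith),
    isFloat_natG he (1) (2 * q + 5) (by push_cast; rw [pow_add, pow_mul']; ring)
      (by rw [abs_of_pos (by positivity), hp]; linarith),
    isFloat_natG he (-(8 * 2 ^ q - 1)) (4 * q + 11) (by push_cast; rw [pow_add, pow_mul']; ring)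
      (by rw [abs_of_neg (by linarith), hp]; linarith),
    isFloat_natG he (3) (3 * q + 7) (by push_cast; rw [pow_add, pow_mul']; ring)
      (by rw [abs_of_pos (by positivity), hp]; linarith),
    isFloat_natG he (4 * 2 ^ q + 1) (q + 3) (by push_cast; rw [pow_add]; ring)
      (by rw [abs_of_pos (by positivity), hp]; linarith),
    isFloat_natG he (-(4 * 2 ^ q - 1)) (0) (by push_cast; ring)
      (by rw [abs_of_neg (by linarith), hp]; linarith),
    isFloat_natG he (-(4 * 2 ^ q - 1)) (q + 3) (by push_cast; rw [pow_add]; ring)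
      (by rw [abs_of_neg (by linarith), hp]; linarith),
    isFloat_natG he (6 * 2 ^ q + 1) (2 * q + 6) (by push_cast; rw [pow_add, pow_mul']; ring)
      (by rw [abs_of_pos (by positivity), hp]; linarith),
    isFloat_natG he (-(8 * 2 ^ q - 1)) (q + 2) (by push_cast; rw [pow_add]; ring)
      (by rw [abs_of_neg (by linarith), hp]; linarith),
    isFloat_natG he (1) (0) (by push_cast; ring)
      (by rw [abs_of_pos (by positivity), hp]; linarith),
    isFloat_natG he (-(4 * 2 ^ q + 1)) (4 * q + 12) (by push_cast; rw [pow_add, pow_mul']; ring)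
      (by rw [abs_of_neg (by linarith), hp]; linarith),
    isFloat_natG he (4 * 2 ^ q + 1) (3 * q + 9) (by push_cast; rw [pow_add, pow_mul']; ring)
      (by rw [abs_of_pos (by positivity), hp]; linarith)⟩

/-- The eight FAST-TWO-SUMs of the window pass: downward `((3h/2+1)·2^(5p), −(h−1)·2^(4p)) ↦` inert,
`(−(h−1)·2^(4p), −(h−1)·2^(3p)) ↦ (−(2h−1)·2^(4p−1), 2^(3p))`, `(2^(3p), −(h−1)·2^(2p−1)) ↦ (3·2^(3p−2), 2^(2p−1))`
[the tie], `(2^(2p−1), h+1) ↦ ((h+1)·2^p, −(h−1))`; upward `((h+1)·2^p, −(h−1)) ↦` inert,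
`(3·2^(3p−2), (h+1)·2^p) ↦ ((3h/2+1)·2^(2p), −(h−1)·2^p)`, `(−(2h−1)·2^(4p−1), (3h/2+1)·2^(2p)) ↦` inert,
`((3h/2+1)·2^(5p), −(2h−1)·2^(4p−1)) ↦` inert. [cite: Shewchuk1997, §2.3 Theorem 6; BoldoEtAl2023, §2.2] -/
theorem windowG_fastTwoSum (he : em ≤ 0) :
    fastTwoSum (roundTiesEven (q + 3) em) ((6 * 2 ^ q + 1) * (32768 * (2 ^ q) ^ 5)) (-(4 * 2 ^ q - 1) * (4096 * (2 ^ q) ^ 4)) =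
        ((6 * 2 ^ q + 1) * (32768 * (2 ^ q) ^ 5), -(4 * 2 ^ q - 1) * (4096 * (2 ^ q) ^ 4)) ∧
      fastTwoSum (roundTiesEven (q + 3) em) (-(4 * 2 ^ q - 1) * (4096 * (2 ^ q) ^ 4)) (-(4 * 2 ^ q - 1) * (512 * (2 ^ q) ^ 3)) =
        (-(8 * 2 ^ q - 1) * (2048 * (2 ^ q) ^ 4), 512 * (2 ^ q) ^ 3) ∧
      fastTwoSum (roundTiesEven (q + 3) em) (512 * (2 ^ q) ^ 3) (-(4 * 2 ^ q - 1) * (32 * (2 ^ q) ^ 2)) =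
        (384 * (2 ^ q) ^ 3, 32 * (2 ^ q) ^ 2) ∧
      fastTwoSum (roundTiesEven (q + 3) em) (32 * (2 ^ q) ^ 2) ((4 * 2 ^ q + 1)) =
        ((4 * 2 ^ q + 1) * (8 * 2 ^ q), -(4 * 2 ^ q - 1)) ∧
      fastTwoSum (roundTiesEven (q + 3) em) ((4 * 2 ^ q + 1) * (8 * 2 ^ q)) (-(4 * 2 ^ q - 1)) =
        ((4 * 2 ^ q + 1) * (8 * 2 ^ q), -(4 * 2 ^ q - 1)) ∧
      fastTwoSum (roundTiesEven (q + 3) em) (384 * (2 ^ q) ^ 3) ((4 * 2 ^ q + 1) * (8 * 2 ^ q)) =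
        ((6 * 2 ^ q + 1) * (64 * (2 ^ q) ^ 2), -(4 * 2 ^ q - 1) * (8 * 2 ^ q)) ∧
      fastTwoSum (roundTiesEven (q + 3) em) (-(8 * 2 ^ q - 1) * (2048 * (2 ^ q) ^ 4)) ((6 * 2 ^ q + 1) * (64 * (2 ^ q) ^ 2)) =
        (-(8 * 2 ^ q - 1) * (2048 * (2 ^ q) ^ 4), (6 * 2 ^ q + 1) * (64 * (2 ^ q) ^ 2)) ∧
      fastTwoSum (roundTiesEven (q + 3) em) ((6 * 2 ^ q + 1) * (32768 * (2 ^ q) ^ 5)) (-(8 * 2 ^ q - 1) * (2048 * (2 ^ q) ^ 4)) =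
        ((6 * 2 ^ q + 1) * (32768 * (2 ^ q) ^ 5), -(8 * 2 ^ q - 1) * (2048 * (2 ^ q) ^ 4)) := by
  have hp : 1 ≤ q + 3 := by omega
  have hfl := isRoundNearest_roundTiesEven (p := q + 3) (emin := em) hp
  obtain ⟨hY, hY2, hY3, hY4, hY5, hY6⟩ := yfactsG q
  obtain ⟨s_k2, s_k1, s_k0, s_b, s_a, s_c3, s_c2, s_d, s_g3, s_g4, s_m0, s_m1, s_m2, s_f1, s_one, s_S, s_a3⟩ := signsG q
  obtain ⟨f_k2, f_k1, f_k0, f_b, f_a, f_c3, f_c2, f_d, f_g3, f_g4, f_m0, f_m1, f_m2, f_f1, f_one, f_S, f_a3⟩ := windowG_isFloat (q := q) he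
  refine ⟨?_, ?_, ?_, ?_, ?_, ?_, ?_, ?_⟩
  · rw [f2s_eqG hp (s := (6 * 2 ^ q + 1) * (32768 * (2 ^ q) ^ 5)) hfl f_k2 f_k1
      (by rw [abs_of_neg s_k1, abs_of_pos s_k2]; linarith) (rneG_k2_k1 he)]
    congr 1
    ring
  · rw [f2s_eqG hp (s := -(8 * 2 ^ q - 1) * (2048 * (2 ^ q) ^ 4)) hfl f_k1 f_k0
      (by rw [abs_of_neg s_k0, abs_of_neg s_k1]; linarith) (rneG_k1_k0 he)]
    congr 1
    ring
  · rw [f2s_eqG hp (s := 384 * (2 ^ q) ^ 3) hfl f_c3 f_b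
      (by rw [abs_of_neg s_b, abs_of_pos s_c3]; linarith) (rneG_c3_b he)]
    congr 1
    ring
  · rw [f2s_eqG hp (s := (4 * 2 ^ q + 1) * (8 * 2 ^ q)) hfl f_c2 f_a
      (by rw [abs_of_pos s_a, abs_of_pos s_c2]; linarith) (rneG_c2_a he)]
    congr 1
    ring
  · rw [f2s_eqG hp (s := (4 * 2 ^ q + 1) * (8 * 2 ^ q)) hfl f_g4 f_m0
      (by rw [abs_of_neg s_m0, abs_of_pos s_g4]; linarith) (rneG_c2_a' he)]
    congr 1
    ring
  · rw [f2s_eqG hp (s := (6 * 2 ^ q + 1) * (64 * (2 ^ q) ^ 2)) hfl f_g3 f_g4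
      (by rw [abs_of_pos s_g4, abs_of_pos s_g3]; linarith) (rneG_g3_g4 he)]
    congr 1
    ring
  · rw [f2s_eqG hp (s := -(8 * 2 ^ q - 1) * (2048 * (2 ^ q) ^ 4)) hfl f_d f_m2
      (by rw [abs_of_pos s_m2, abs_of_neg s_d]; linarith) (rneG_d_m2 he)]
    congr 1
    ring
  · rw [f2s_eqG hp (s := (6 * 2 ^ q + 1) * (32768 * (2 ^ q) ^ 5)) hfl f_k2 f_d
      (by rw [abs_of_neg s_d, abs_of_pos s_k2]; linarith) (rneG_k2_d he)]
    congr 1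
    ring

/-- The downward sweep of the window: from `Q = (3h/2+1)·2^(5p)` over `−(h−1)·2^(4p), −(h−1)·2^(3p),
−(h−1)·2^(2p−1), h+1` it emits `(3h/2+1)·2^(5p), −(2h−1)·2^(4p−1), 3·2^(3p−2), (h+1)·2^p` and ends with the
carry `−(h−1)`. [cite: Shewchuk1997, §2.7 p. 332 (COMPRESS), Lines 1–9] -/
theorem compressDown_windowG (he : em ≤ 0) :
    compressDown (roundTiesEven (q + 3) em) ((6 * 2 ^ q + 1) * (32768 * (2 ^ q) ^ 5))
        [-(4 * 2 ^ q - 1) * (4096 * (2 ^ q) ^ 4), -(4 * 2 ^ q - 1) * (512 * (2 ^ q) ^ 3), -(4 * 2 ^ q - 1) * (32 * (2 ^ q) ^ 2), (4 * 2 ^ q + 1)] =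
      ([(6 * 2 ^ q + 1) * (32768 * (2 ^ q) ^ 5), -(8 * 2 ^ q - 1) * (2048 * (2 ^ q) ^ 4), 384 * (2 ^ q) ^ 3, (4 * 2 ^ q + 1) * (8 * 2 ^ q)], -(4 * 2 ^ q - 1)) := by
  obtain ⟨s_k2, s_k1, s_k0, s_b, s_a, s_c3, s_c2, s_d, s_g3, s_g4, s_m0, s_m1, s_m2, s_f1, s_one, s_S, s_a3⟩ := signsG q
  obtain ⟨F1, F2, F3, F4, -, -, -, -⟩ := windowG_fastTwoSum (q := q) he
  rw [compressDown_cons_of_ne_zero (by rw [F1]; exact s_k1.ne), F1]; simp only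
  rw [compressDown_cons_of_ne_zero (by rw [F2]; exact s_c3.ne'), F2]; simp only
  rw [compressDown_cons_of_ne_zero (by rw [F3]; exact s_c2.ne'), F3]; simp only
  rw [compressDown_cons_of_ne_zero (by rw [F4]; exact s_m0.ne), F4]
  simp

/-- **The window pass** at precision `p = q + 3`:
`COMPRESS⟨h+1, −(h−1)·2^(2p−1), −(h−1)·2^(3p), −(h−1)·2^(4p), (3h/2+1)·2^(5p)⟩ =
⟨−(h−1), −(h−1)·2^p, (3h/2+1)·2^(2p), −(2h−1)·2^(4p−1), (3h/2+1)·2^(5p)⟩` (ties-to-even, `em ≤ 0`).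
[cite: Shewchuk1997, §2.7 p. 332 (COMPRESS)] -/
theorem compress_windowG (he : em ≤ 0) :
    compress (roundTiesEven (q + 3) em)
        [(4 * 2 ^ q + 1), -(4 * 2 ^ q - 1) * (32 * (2 ^ q) ^ 2), -(4 * 2 ^ q - 1) * (512 * (2 ^ q) ^ 3), -(4 * 2 ^ q - 1) * (4096 * (2 ^ q) ^ 4), (6 * 2 ^ q + 1) * (32768 * (2 ^ q) ^ 5)] =
      [-(4 * 2 ^ q - 1), -(4 * 2 ^ q - 1) * (8 * 2 ^ q), (6 * 2 ^ q + 1) * (64 * (2 ^ q) ^ 2), -(8 * 2 ^ q - 1) * (2048 * (2 ^ q) ^ 4), (6 * 2 ^ q + 1) * (32768 * (2 ^ q) ^ 5)] := by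
  obtain ⟨s_k2, s_k1, s_k0, s_b, s_a, s_c3, s_c2, s_d, s_g3, s_g4, s_m0, s_m1, s_m2, s_f1, s_one, s_S, s_a3⟩ := signsG q
  obtain ⟨-, -, -, -, U1, U2, U3, U4⟩ := windowG_fastTwoSum (q := q) he
  have hc : compress (roundTiesEven (q + 3) em)
        [(4 * 2 ^ q + 1), -(4 * 2 ^ q - 1) * (32 * (2 ^ q) ^ 2), -(4 * 2 ^ q - 1) * (512 * (2 ^ q) ^ 3), -(4 * 2 ^ q - 1) * (4096 * (2 ^ q) ^ 4), (6 * 2 ^ q + 1) * (32768 * (2 ^ q) ^ 5)] =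
      compressUp (roundTiesEven (q + 3) em) (-(4 * 2 ^ q - 1))
        [(4 * 2 ^ q + 1) * (8 * 2 ^ q), 384 * (2 ^ q) ^ 3, -(8 * 2 ^ q - 1) * (2048 * (2 ^ q) ^ 4), (6 * 2 ^ q + 1) * (32768 * (2 ^ q) ^ 5)] := by
    simp only [compress, List.reverse_cons, List.reverse_nil, List.nil_append, List.cons_append,
      compressDown_windowG (q := q) he]
  rw [hc, compressUp_cons_of_ne_zero (by rw [U1]; exact s_m0.ne), U1]; simp only
  rw [compressUp_cons_of_ne_zero (by rw [U2]; exact s_m1.ne), U2]; simp only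
  rw [compressUp_cons_of_ne_zero (by rw [U3]; exact s_m2.ne'), U3]; simp only
  rw [compressUp_cons_of_ne_zero (by rw [U4]; exact s_d.ne), U4]
  simp


/-- The four FAST-TWO-SUMs of the last step: downward `((3h/2+1)·2^(2p), −(h−1)·2^p) ↦` inert,
`(−(h−1)·2^p, −(h−1)) ↦ (−(2h−1)·2^(p−1), 1)`; upward `(−(2h−1)·2^(p−1), 1) ↦` inert,
`((3h/2+1)·2^(2p), −(2h−1)·2^(p−1)) ↦` inert. [cite: Shewchuk1997, §2.3 Theorem 6; BoldoEtAl2023, §2.2] -/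
theorem kinkG_fastTwoSum (he : em ≤ 0) :
    fastTwoSum (roundTiesEven (q + 3) em) ((6 * 2 ^ q + 1) * (64 * (2 ^ q) ^ 2)) (-(4 * 2 ^ q - 1) * (8 * 2 ^ q)) =
        ((6 * 2 ^ q + 1) * (64 * (2 ^ q) ^ 2), -(4 * 2 ^ q - 1) * (8 * 2 ^ q)) ∧
      fastTwoSum (roundTiesEven (q + 3) em) (-(4 * 2 ^ q - 1) * (8 * 2 ^ q)) (-(4 * 2 ^ q - 1)) =
        (-(8 * 2 ^ q - 1) * (4 * 2 ^ q), 1) ∧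
      fastTwoSum (roundTiesEven (q + 3) em) (-(8 * 2 ^ q - 1) * (4 * 2 ^ q)) (1) =
        (-(8 * 2 ^ q - 1) * (4 * 2 ^ q), 1) ∧
      fastTwoSum (roundTiesEven (q + 3) em) ((6 * 2 ^ q + 1) * (64 * (2 ^ q) ^ 2)) (-(8 * 2 ^ q - 1) * (4 * 2 ^ q)) =
        ((6 * 2 ^ q + 1) * (64 * (2 ^ q) ^ 2), -(8 * 2 ^ q - 1) * (4 * 2 ^ q)) := by
  have hp : 1 ≤ q + 3 := by omega
  have hfl := isRoundNearest_roundTiesEven (p := q + 3) (emin := em) hp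
  obtain ⟨hY, hY2, hY3, hY4, hY5, hY6⟩ := yfactsG q
  obtain ⟨s_k2, s_k1, s_k0, s_b, s_a, s_c3, s_c2, s_d, s_g3, s_g4, s_m0, s_m1, s_m2, s_f1, s_one, s_S, s_a3⟩ := signsG q
  obtain ⟨f_k2, f_k1, f_k0, f_b, f_a, f_c3, f_c2, f_d, f_g3, f_g4, f_m0, f_m1, f_m2, f_f1, f_one, f_S, f_a3⟩ := windowG_isFloat (q := q) he
  refine ⟨?_, ?_, ?_, ?_⟩
  · rw [f2s_eqG hp (s := (6 * 2 ^ q + 1) * (64 * (2 ^ q) ^ 2)) hfl f_m2 f_m1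
      (by rw [abs_of_neg s_m1, abs_of_pos s_m2]; linarith) (rneG_m2_m1 he)]
    congr 1
    ring
  · rw [f2s_eqG hp (s := -(8 * 2 ^ q - 1) * (4 * 2 ^ q)) hfl f_m1 f_m0
      (by rw [abs_of_neg s_m0, abs_of_neg s_m1]; linarith) (rneG_m1_m0 he)]
    congr 1
    ring
  · rw [f2s_eqG hp (s := -(8 * 2 ^ q - 1) * (4 * 2 ^ q)) hfl f_f1 f_one
      (by rw [abs_of_pos s_one, abs_of_neg s_f1]; linarith) (rneG_f1_one he)]
    congr 1
    ring
  · rw [f2s_eqG hp (s := (6 * 2 ^ q + 1) * (64 * (2 ^ q) ^ 2)) hfl f_m2 f_f1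
      (by rw [abs_of_neg s_f1, abs_of_pos s_m2]; linarith) (rneG_m2_f1 he)]
    congr 1
    ring

/-- Downward sweep of the last step: emits `(3h/2+1)·2^(2p), −(2h−1)·2^(p−1)`, bottom carry `1`.
[cite: Shewchuk1997, §2.7 p. 332 (COMPRESS), Lines 1–9] -/
theorem compressDown_kinkG (he : em ≤ 0) :
    compressDown (roundTiesEven (q + 3) em) ((6 * 2 ^ q + 1) * (64 * (2 ^ q) ^ 2)) [-(4 * 2 ^ q - 1) * (8 * 2 ^ q), -(4 * 2 ^ q - 1)] =
      ([(6 * 2 ^ q + 1) * (64 * (2 ^ q) ^ 2), -(8 * 2 ^ q - 1) * (4 * 2 ^ q)], 1) := by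
  obtain ⟨s_k2, s_k1, s_k0, s_b, s_a, s_c3, s_c2, s_d, s_g3, s_g4, s_m0, s_m1, s_m2, s_f1, s_one, s_S, s_a3⟩ := signsG q
  obtain ⟨F1, F2, -, -⟩ := kinkG_fastTwoSum (q := q) he
  rw [compressDown_cons_of_ne_zero (by rw [F1]; exact s_m1.ne), F1]; simp only
  rw [compressDown_cons_of_ne_zero (by rw [F2]; exact one_ne_zero), F2]
  simp

/-- **The kink's last step**: `COMPRESS⟨−(h−1), −(h−1)·2^p, (3h/2+1)·2^(2p)⟩ = ⟨1, −(2h−1)·2^(p−1), (3h/2+1)·2^(2p)⟩`.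
[cite: Shewchuk1997, §2.7 p. 332 (COMPRESS)] -/
theorem compress_kinkG (he : em ≤ 0) :
    compress (roundTiesEven (q + 3) em) [-(4 * 2 ^ q - 1), -(4 * 2 ^ q - 1) * (8 * 2 ^ q), (6 * 2 ^ q + 1) * (64 * (2 ^ q) ^ 2)] =
      [1, -(8 * 2 ^ q - 1) * (4 * 2 ^ q), (6 * 2 ^ q + 1) * (64 * (2 ^ q) ^ 2)] := by
  obtain ⟨s_k2, s_k1, s_k0, s_b, s_a, s_c3, s_c2, s_d, s_g3, s_g4, s_m0, s_m1, s_m2, s_f1, s_one, s_S, s_a3⟩ := signsG q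
  obtain ⟨-, -, U1, U2⟩ := kinkG_fastTwoSum (q := q) he
  have hc : compress (roundTiesEven (q + 3) em) [-(4 * 2 ^ q - 1), -(4 * 2 ^ q - 1) * (8 * 2 ^ q), (6 * 2 ^ q + 1) * (64 * (2 ^ q) ^ 2)] =
      compressUp (roundTiesEven (q + 3) em) 1 [-(8 * 2 ^ q - 1) * (4 * 2 ^ q), (6 * 2 ^ q + 1) * (64 * (2 ^ q) ^ 2)] := by
    simp only [compress, List.reverse_cons, List.reverse_nil, List.nil_append, List.cons_append,
      compressDown_kinkG (q := q) he]
  rw [hc, compressUp_cons_of_ne_zero (by rw [U1]; exact one_ne_zero), U1]; simp only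
  rw [compressUp_cons_of_ne_zero (by rw [U2]; exact s_f1.ne), U2]
  simp

/-- … and `⟨1, −(2h−1)·2^(p−1), (3h/2+1)·2^(2p)⟩` is FIXED by COMPRESS (the same four FAST-TWO-SUMs).
[cite: Shewchuk1997, §2.7 p. 332 (COMPRESS)] -/
theorem compress_kinkG_final (he : em ≤ 0) :
    compress (roundTiesEven (q + 3) em) [1, -(8 * 2 ^ q - 1) * (4 * 2 ^ q), (6 * 2 ^ q + 1) * (64 * (2 ^ q) ^ 2)] =
      [1, -(8 * 2 ^ q - 1) * (4 * 2 ^ q), (6 * 2 ^ q + 1) * (64 * (2 ^ q) ^ 2)] := by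
  obtain ⟨s_k2, s_k1, s_k0, s_b, s_a, s_c3, s_c2, s_d, s_g3, s_g4, s_m0, s_m1, s_m2, s_f1, s_one, s_S, s_a3⟩ := signsG q
  obtain ⟨-, -, U1, U2⟩ := kinkG_fastTwoSum (q := q) he
  have hd : compressDown (roundTiesEven (q + 3) em) ((6 * 2 ^ q + 1) * (64 * (2 ^ q) ^ 2)) [-(8 * 2 ^ q - 1) * (4 * 2 ^ q), 1] =
      ([(6 * 2 ^ q + 1) * (64 * (2 ^ q) ^ 2), -(8 * 2 ^ q - 1) * (4 * 2 ^ q)], 1) := by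
    rw [compressDown_cons_of_ne_zero (by rw [U2]; exact s_f1.ne), U2]; simp only
    rw [compressDown_cons_of_ne_zero (by rw [U1]; exact one_ne_zero), U1]
    simp
  have hc : compress (roundTiesEven (q + 3) em) [1, -(8 * 2 ^ q - 1) * (4 * 2 ^ q), (6 * 2 ^ q + 1) * (64 * (2 ^ q) ^ 2)] =
      compressUp (roundTiesEven (q + 3) em) 1 [-(8 * 2 ^ q - 1) * (4 * 2 ^ q), (6 * 2 ^ q + 1) * (64 * (2 ^ q) ^ 2)] := by
    simp only [compress, List.reverse_cons, List.reverse_nil, List.nil_append, List.cons_append, hd]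
  rw [hc, compressUp_cons_of_ne_zero (by rw [U1]; exact one_ne_zero), U1]; simp only
  rw [compressUp_cons_of_ne_zero (by rw [U2]; exact s_f1.ne), U2]
  simp


/-- The four INERT FAST-TWO-SUMs around the window (each returns its arguments): inside a pair block
`(−(h−1)·2^(2p−1), h+1)`, across a block boundary `((h+1)·2^(3p), −(h−1)·2^(2p−1))`, the kink's bottom over
the pair below `(−(h−1)·2^(3p), −(h−1)·2^(2p−1))`, and the summit over the kink's top
`(−(h+1)·2^(4p), (3h/2+1)·2^(2p))` — the chain hypotheses of locality (`CompressLocality.lean`) for the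
`p`-generic family. [cite: Shewchuk1997, §2.3 Theorem 6; BoldoEtAl2023, §2.2] -/
theorem windowG_inert (he : em ≤ 0) :
    fastTwoSum (roundTiesEven (q + 3) em) (-(4 * 2 ^ q - 1) * (32 * (2 ^ q) ^ 2)) ((4 * 2 ^ q + 1)) =
        (-(4 * 2 ^ q - 1) * (32 * (2 ^ q) ^ 2), (4 * 2 ^ q + 1)) ∧
      fastTwoSum (roundTiesEven (q + 3) em) ((4 * 2 ^ q + 1) * (512 * (2 ^ q) ^ 3)) (-(4 * 2 ^ q - 1) * (32 * (2 ^ q) ^ 2)) =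
        ((4 * 2 ^ q + 1) * (512 * (2 ^ q) ^ 3), -(4 * 2 ^ q - 1) * (32 * (2 ^ q) ^ 2)) ∧
      fastTwoSum (roundTiesEven (q + 3) em) (-(4 * 2 ^ q - 1) * (512 * (2 ^ q) ^ 3)) (-(4 * 2 ^ q - 1) * (32 * (2 ^ q) ^ 2)) =
        (-(4 * 2 ^ q - 1) * (512 * (2 ^ q) ^ 3), -(4 * 2 ^ q - 1) * (32 * (2 ^ q) ^ 2)) ∧
      fastTwoSum (roundTiesEven (q + 3) em) (-(4 * 2 ^ q + 1) * (4096 * (2 ^ q) ^ 4)) ((6 * 2 ^ q + 1) * (64 * (2 ^ q) ^ 2)) =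
        (-(4 * 2 ^ q + 1) * (4096 * (2 ^ q) ^ 4), (6 * 2 ^ q + 1) * (64 * (2 ^ q) ^ 2)) := by
  have hp : 1 ≤ q + 3 := by omega
  have hfl := isRoundNearest_roundTiesEven (p := q + 3) (emin := em) hp
  obtain ⟨hY, hY2, hY3, hY4, hY5, hY6⟩ := yfactsG q
  obtain ⟨s_k2, s_k1, s_k0, s_b, s_a, s_c3, s_c2, s_d, s_g3, s_g4, s_m0, s_m1, s_m2, s_f1, s_one, s_S, s_a3⟩ := signsG q
  obtain ⟨f_k2, f_k1, f_k0, f_b, f_a, f_c3, f_c2, f_d, f_g3, f_g4, f_m0, f_m1, f_m2, f_f1, f_one, f_S, f_a3⟩ := windowG_isFloat (q := q) he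
  refine ⟨?_, ?_, ?_, ?_⟩
  · rw [f2s_eqG hp (s := -(4 * 2 ^ q - 1) * (32 * (2 ^ q) ^ 2)) hfl f_b f_a
      (by rw [abs_of_pos s_a, abs_of_neg s_b]; linarith) (rneG_b_a he)]
    congr 1
    ring
  · rw [f2s_eqG hp (s := (4 * 2 ^ q + 1) * (512 * (2 ^ q) ^ 3)) hfl f_a3 f_b
      (by rw [abs_of_neg s_b, abs_of_pos s_a3]; linarith) (rneG_a3_b he)]
    congr 1
    ring
  · rw [f2s_eqG hp (s := -(4 * 2 ^ q - 1) * (512 * (2 ^ q) ^ 3)) hfl f_k0 f_b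
      (by rw [abs_of_neg s_b, abs_of_neg s_k0]; linarith) (rneG_k0_b he)]
    congr 1
    ring
  · rw [f2s_eqG hp (s := -(4 * 2 ^ q + 1) * (4096 * (2 ^ q) ^ 4)) hfl f_S f_m2
      (by rw [abs_of_pos s_m2, abs_of_neg s_S]; linarith) (rneG_S_m2 he)]
    congr 1
    ring

/-! ### The instance `p = 3` (`q = 0`): the statements of `CompressWindow.lean` -/

/-- `q = 0`: `COMPRESS⟨5, −96, −1536, −12288, 229376⟩ = ⟨−3, −24, 448, −14336, 229376⟩` at `p = 3` =
`compress_window3` of `CompressWindow.lean` (not imported). [cite: Shewchuk1997, §2.7 p. 332 (COMPRESS)] -/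
theorem compress_windowG_three (he : em ≤ 0) :
    compress (roundTiesEven 3 em) [5, -96, -1536, -12288, 229376] = [-3, -24, 448, -14336, 229376] := by
  have h := compress_windowG (q := 0) he; norm_num at h; exact h

/-- `q = 0`: `COMPRESS⟨−3, −24, 448⟩ = ⟨1, −28, 448⟩` at `p = 3` (`compress_kink3` of `CompressWindow.lean`).
[cite: Shewchuk1997, §2.7 p. 332 (COMPRESS)] -/
theorem compress_kinkG_three (he : em ≤ 0) :
    compress (roundTiesEven 3 em) [-3, -24, 448] = [1, -28, 448] := by
  have h := compress_kinkG (q := 0) he; norm_num at h; exact h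

/-- `q = 0`: `⟨1, −28, 448⟩` is fixed at `p = 3` (`compress_kink3_final` of `CompressWindow.lean`).
[cite: Shewchuk1997, §2.7 p. 332 (COMPRESS)] -/
theorem compress_kinkG_final_three (he : em ≤ 0) :
    compress (roundTiesEven 3 em) [1, -28, 448] = [1, -28, 448] := by
  have h := compress_kinkG_final (q := 0) he; norm_num at h; exact h


end Summit.Ventures.CertifiedArithmetic.Expansions
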